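/-
COR-CM (cell pub-hodgecm2, stage 2 of the Hodge ladder) — Δ2 BRIDGE, X1 (J) pin, piece **(J2) «ALBANESE ON COMPONENTS»**,
HOLE-FREE GENERIC CORE, sequel: the transition square of `CorCM/D2Bridge/AlbaneseOnPieceCore.lean` §5 INSTANTIATED at Liu's
own functoriality data — `Alb_u` (Def. 2.3, kernel construction `Albanese.map`), the transition homomorphisms
`Alb_{u^{K'}_K} = Sec42Data.Atr` of `{A_K}_K` (§4.2 l. 2070; LAW (iii) of the (J2) brief) and the Hecke translates
`Alb(T_g) = HeckeTranslates.albTr` (§4.2 l. 2074; LAW (iv)).  Provisional fifth hand own-crow g92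
(prover-pub-hodgecm-own-crow-g92-0) for the SEAT ASK d2bridge-prove-5 (pub-hodgecm2 OPS-REQUESTS l. 377).  THEOREMS ONLY;
Literature-only imports besides the core; no manifest path; nothing landed is edited or restated.  FRAMING: HC_CM is NOT
proved; «Δ2 BRIDGE CLOSED» is NOT claimed; the PIN instance (Model cone) is NOT in this file.
-/
import Summits.HodgeConjecture.CorCM.D2Bridge.AlbaneseOnPieceCore
import Literature.NumberTheory.Automorphic.Liu2021.AppendixC.HeckeTranslates
import HarnessLib

/-!
# Δ2 bridge, (J2) core — functoriality: the squares for `Alb_u`, `Alb_{u^{K'}_K}` (LAW (iii)) and `Alb(T_g)` (LAW (iv))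

[Liu2021] Y. Liu, arXiv:2102.11518 = Camb. J. Math. 9 (2021): Def. 2.3 (l. 1206–1208) «the induced morphism `Alb_u : Alb_Y → Alb_X`
by the universal property, which satisfies `Alb_u ∘ α_X = α_Y ∘ ∇u`» (composable READING G3 `α_Y ≫ Alb_u = ∇u ≫ α_X`); §4.2
l. 2070–2074 «By functoriality, we obtain a projective system `{A_K}_K` […] the Hecke correspondences provide a homomorphism
`𝔾(𝔸_F^∞) → Aut_E(A_∞)`».  For each of the three, the generic square `albPair_comp_baseChange` ∕ `albOnPiece_comp_baseChange` ∕
`pull_albOnPiece_comp_baseChange` of the core is applied to the printed identity (`Albanese.α_map`, `Sec42Data.α_Atr`,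
`HeckeTranslates.α_albTr` — the last by unfolding `albTr := Albanese.map`) and to `∇u` over `u × u` (`Nabla.map_incl`,
`Sec42Data.nablaTr_incl`): for pieces `Y' ↪ X' ⊗ ℂ`, `Y ↪ X ⊗ ℂ` corresponding under `u_ℂ`,
`albPair a' inj' ≫ (Alb_u)_ℂ = (v × v) ≫ albPair a inj`, pointed `(α')_{y'}|_{Y'} ≫ (Alb_u)_ℂ = v ≫ (α)_{v(y')}|_Y`, and on `Hⁱ`
with any base points.  These are the generic halves of the Δ2 bridge's S2 laws `phiStar_comp` ∕ `pbQ` (levels) and `hU` ∕ `hjH`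
(Hecke); the PIN supplies the pieces `Y ≅ P_Γ` and the correspondences `v` from the `hUnif` cofan.  HC_CM is NOT proved.

## References
* [Liu2021] Y. Liu, arXiv:2102.11518 = Camb. J. Math. 9 (2021): §2.1 Def. 2.1 (1) (l. 1174–1176), Def. 2.3 (l. 1206–1208), proof of
  Lemma 2.4 (1) (l. 1220–1228); §4.2 l. 2062–2074.
* [Milne2005ShimuraVarieties] J. S. Milne, *Introduction to Shimura varieties* (2005), §5 p. 58, §13 p. 118 (Hecke action `T(g)`).
-/

set_option autoImplicit false

noncomputable section

open CategoryTheory CategoryTheory.Limits AlgebraicGeometry MonoidalCategory CartesianMonoidalCategory NumberField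
open Literature.AlgebraicGeometry.Motives
open Literature.AlgebraicGeometry.HodgeTheory
open Literature.NumberTheory.Automorphic.Liu2021.AppendixC
open scoped MonObj

namespace Summit.HodgeConjecture.CorCM.D2Bridge

open AbelianVariety (bcSpec bcFunctor)

variable {k : Type} [Field k] [Algebra k ℂ] {X : SchemeOver k} (a : Albanese X)
  {Y : SchemeOver ℂ} (inj : Y ⟶ (bcFunctor k ℂ).obj X)

/-! ## §0 LAW (ii): re-parametrisation of a piece (`u = 𝟙`, `Alb_u = 𝟙`) -/

section Reparam

variable {Y' : SchemeOver ℂ} (inj' : Y' ⟶ (bcFunctor k ℂ).obj X) (v : Y' ⟶ Y)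

/-- **LAW (ii) — re-parametrising a piece does not change `α` on it**: if `inj' = v ≫ inj` (at the pin: `v = t_γ : P_{Γ.conj h} ⥲
P_{Γ.conj h'}` the rational translate of the tower's relation `Rel Γ γ h h'`, both pieces mapping to the SAME component of `X_K ⊗ ℂ`),
then `albPair a inj' = (v × v) ≫ albPair a inj` — the transition square of the core at `u := 𝟙`, `∇u := 𝟙`, `Alb_u := 𝟙`.
[cite: Liu2021, §2.1 Def. 2.3 (l. 1202–1208) and proof of Lemma 2.4 (1) (l. 1220–1222)] -/
theorem albPair_reparam [GeometricallyIrreducible Y.hom] [GeometricallyIrreducible Y'.hom] (hv : v ≫ inj = inj') :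
    albPair a inj' = (v ⊗ₘ v) ≫ albPair a inj := by
  have h := albPair_comp_baseChange a inj a (𝟙 X) (𝟙 a.nabla.N) (𝟙 a.Alb) inj' v
    (by rw [Category.id_comp, tensorHom_id, id_whiskerRight, Category.comp_id])
    (by rw [Category.id_comp]; exact Category.comp_id _)
    (by rw [hv, CategoryTheory.Functor.map_id, Category.comp_id])
  rw [AbelianVariety.Hom.baseChange_id] at h
  have h1 : (𝟙 (a.Alb.baseChange ℂ) : a.Alb.baseChange ℂ ⟶ a.Alb.baseChange ℂ).hom.hom.hom = 𝟙 _ := rfl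
  rw [h1, Category.comp_id] at h
  exact h

/-- LAW (ii), pointed form: `(α)_{y'}|_{Y'} = v ≫ (α)_{v(y')}|_Y` for `inj' = v ≫ inj`. [cite: Liu2021, proof of Lemma 2.4 (1) (l. 1220–1222)] -/
theorem albOnPiece_reparam [GeometricallyIrreducible Y.hom] [GeometricallyIrreducible Y'.hom] (hv : v ≫ inj = inj')
    (y' : AlgPoints Y' ℂ) : albOnPiece a inj' y' = v ≫ albOnPiece a inj (y' ≫ v) := by
  rw [albOnPiece_def, albOnPiece_def, albPair_reparam a inj inj' v hv, ← Category.assoc, lift_map, Category.id_comp,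
    comp_lift_assoc, Category.comp_id, ← Category.assoc v (toSpecOver Y), Jacobian.comp_toSpecOver, Category.assoc]

/-- LAW (ii) on `Hⁱ`, ANY base points (smooth projective pieces): `((α)_{y'}|_{Y'})^* = v^* ∘ ((α)_{y}|_Y)^*` — the tower relation
`c h = t_γ^* (c h')` for the family `h ↦ ((α_K)_x|_{P_h} ≫ f_ℂ)^* ℓ` of the Δ2 bridge's S2 `phiStar`. [cite: Liu2021, proof of Lemma 2.4 (1) (l. 1220–1228)] -/
theorem pull_albOnPiece_reparam {n n' : ℕ} (hY : IsSmoothProjective n Y) (hY' : IsSmoothProjective n' Y') (hv : v ≫ inj = inj')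
    (y' : AlgPoints Y' ℂ) (y : AlgPoints Y ℂ) (i : ℕ) :
    haveI := hY.geometricallyIrreducible
    haveI := hY'.geometricallyIrreducible
    BettiUniverse.pull (albOnPiece a inj' y') i = BettiUniverse.pull v i ∘ₗ BettiUniverse.pull (albOnPiece a inj y) i := by
  haveI := hY.geometricallyIrreducible
  haveI := hY'.geometricallyIrreducible
  rw [albOnPiece_reparam a inj inj' v hv y', BettiUniverse.pull_comp, pull_albOnPiece_eq_of_point a inj hY y (y' ≫ v)]

end Reparam

/-! ## §1 The square for `Alb_u` = `Albanese.map` (Def. 2.3) -/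

section AlbaneseMap

variable {X' : SchemeOver k} (a' : Albanese X') (u : X' ⟶ X)
  {Y' : SchemeOver ℂ} (inj' : Y' ⟶ (bcFunctor k ℂ).obj X') (v : Y' ⟶ Y)

/-- **The square for `Alb_u`** (the kernel construction `Albanese.map` of `AppendixC/AlbaneseFunctorial`, «the induced morphism
`Alb_u : Alb_Y → Alb_X` by the universal property», Def. 2.3 l. 1206–1208, with `∇u = Nabla.map`):
`albPair a' inj' ≫ (Alb_u)_ℂ = (v × v) ≫ albPair a inj` for pieces corresponding under `u_ℂ`. [cite: Liu2021, §2.1 Def. 2.1 (1) (l. 1174–1176) and Def. 2.3 (l. 1206–1208)] -/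
theorem albPair_comp_baseChange_map [GeometricallyIrreducible Y.hom] [GeometricallyIrreducible Y'.hom]
    (hv : v ≫ inj = inj' ≫ (bcFunctor k ℂ).map u) :
    albPair a' inj' ≫ (AbelianVariety.Hom.baseChange ℂ (a'.map a u)).hom.hom.hom = (v ⊗ₘ v) ≫ albPair a inj :=
  albPair_comp_baseChange a inj a' u (a'.nabla.map a.nabla u) (a'.map a u) inj' v (a'.nabla.map_incl a.nabla u)
    (a'.α_map a u) hv

/-- The square for `Alb_u`, pointed form: `(α_{X'})_{y'}|_{Y'} ≫ (Alb_u)_ℂ = v ≫ (α_X)_{v(y')}|_Y`. [cite: Liu2021, §2.1 Def. 2.3 (l. 1206–1208) and proof of Lemma 2.4 (1) (l. 1220–1222)] -/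
theorem albOnPiece_comp_baseChange_map [GeometricallyIrreducible Y.hom] [GeometricallyIrreducible Y'.hom]
    (hv : v ≫ inj = inj' ≫ (bcFunctor k ℂ).map u) (y' : AlgPoints Y' ℂ) :
    albOnPiece a' inj' y' ≫ (AbelianVariety.Hom.baseChange ℂ (a'.map a u)).hom.hom.hom = v ≫ albOnPiece a inj (y' ≫ v) :=
  albOnPiece_comp_baseChange a inj a' u (a'.nabla.map a.nabla u) (a'.map a u) inj' v (a'.nabla.map_incl a.nabla u)
    (a'.α_map a u) hv y'

/-- The square for `Alb_u` on `Hⁱ`, any base points (smooth projective pieces). [cite: Liu2021, §2.1 Def. 2.3 (l. 1206–1208) and proof of Lemma 2.4 (1) (l. 1226–1228)] -/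
theorem pull_albOnPiece_comp_baseChange_map {n n' : ℕ} (hY : IsSmoothProjective n Y) (hY' : IsSmoothProjective n' Y')
    (hv : v ≫ inj = inj' ≫ (bcFunctor k ℂ).map u) (y' : AlgPoints Y' ℂ) (y : AlgPoints Y ℂ) (i : ℕ) :
    haveI := hY.geometricallyIrreducible
    haveI := hY'.geometricallyIrreducible
    BettiUniverse.pull (albOnPiece a' inj' y') i ∘ₗ
        BettiUniverse.pull (AbelianVariety.Hom.baseChange ℂ (a'.map a u)).hom.hom.hom i =
      BettiUniverse.pull v i ∘ₗ BettiUniverse.pull (albOnPiece a inj y) i :=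
  pull_albOnPiece_comp_baseChange a inj a' u (a'.nabla.map a.nabla u) (a'.map a u) inj' v hY hY'
    (a'.nabla.map_incl a.nabla u) (a'.α_map a u) hv y' y i

end AlbaneseMap

/-! ## §2 LAW (iii): level transitions `Alb_{u^{K'}_K}`, and LAW (iv): Hecke translates `Alb(T_g)`, at a §4.2 datum -/

section Sec42

variable {F E : Type} [Field F] [NumberField F] [IsTotallyReal F] [Field E] [NumberField E] [Algebra F E]
  [IsTotallyComplex E] [Algebra.IsQuadraticExtension F E] [Algebra E ℂ]
  {P5 : PropC5Data F E} {isotropicAt : ℕ → Prop} (C : Sec42Data P5 isotropicAt)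
  {K K' : C5.SmallLevel C.S.K₀}
  {Y Y' : SchemeOver ℂ} (inj : Y ⟶ (bcFunctor E ℂ).obj (C.X K)) (inj' : Y' ⟶ (bcFunctor E ℂ).obj (C.X K')) (v : Y' ⟶ Y)

/-- **LAW (iii), the LEVEL-TRANSITION square at Liu's §4.2 datum**: for `K' ⊆ K` (`f : K' ⟶ K`), the transition homomorphism
`Alb_{u^{K'}_K} = C.Atr f : A_{K'} → A_K` of the projective system `{A_K}_K` (§4.2 l. 2070, with its printed identity `C.α_Atr f`
and `∇u^{K'}_K = C.nablaTr f` over `u × u`, `C.nablaTr_incl f` — the fields of `AppendixC.Sec42Data` VERBATIM) and pieces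
`Y' ↪ X_{K'} ⊗ ℂ`, `Y ↪ X_K ⊗ ℂ` corresponding under `(u^{K'}_K)_ℂ`:
`albPair (C.alb K') inj' ≫ (Alb_{u^{K'}_K})_ℂ = (v × v) ≫ albPair (C.alb K) inj`. [cite: Liu2021, §4.2 l. 2062–2074 and Def. 2.3 (l. 1207)] -/
theorem albPair_comp_baseChange_Atr [GeometricallyIrreducible Y.hom] [GeometricallyIrreducible Y'.hom] (f : K' ⟶ K)
    (hv : v ≫ inj = inj' ≫ (bcFunctor E ℂ).map (C.cpt.X.map f)) :
    albPair (C.alb K') inj' ≫ (AbelianVariety.Hom.baseChange ℂ (C.Atr f)).hom.hom.hom = (v ⊗ₘ v) ≫ albPair (C.alb K) inj :=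
  albPair_comp_baseChange (C.alb K) inj (C.alb K') (C.cpt.X.map f) (C.nablaTr f) (C.Atr f) inj' v (C.nablaTr_incl f)
    (C.α_Atr f) hv

/-- LAW (iii), pointed form: `(α_{K'})_{y'}|_{Y'} ≫ (Alb_{u^{K'}_K})_ℂ = v ≫ (α_K)_{v(y')}|_Y`. [cite: Liu2021, §4.2 l. 2062–2074 and Def. 2.3 (l. 1207)] -/
theorem albOnPiece_comp_baseChange_Atr [GeometricallyIrreducible Y.hom] [GeometricallyIrreducible Y'.hom] (f : K' ⟶ K)
    (hv : v ≫ inj = inj' ≫ (bcFunctor E ℂ).map (C.cpt.X.map f)) (y' : AlgPoints Y' ℂ) :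
    albOnPiece (C.alb K') inj' y' ≫ (AbelianVariety.Hom.baseChange ℂ (C.Atr f)).hom.hom.hom =
      v ≫ albOnPiece (C.alb K) inj (y' ≫ v) :=
  albOnPiece_comp_baseChange (C.alb K) inj (C.alb K') (C.cpt.X.map f) (C.nablaTr f) (C.Atr f) inj' v (C.nablaTr_incl f)
    (C.α_Atr f) hv y'

/-- LAW (iii) on `Hⁱ`, any base points (the shape of the Δ2 bridge's `phiStar_comp` ∕ `pbQ`). [cite: Liu2021, §4.2 l. 2062–2074 and proof of Lemma 2.4 (1) (l. 1226–1228)] -/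
theorem pull_albOnPiece_comp_baseChange_Atr {n n' : ℕ} (hY : IsSmoothProjective n Y) (hY' : IsSmoothProjective n' Y')
    (f : K' ⟶ K) (hv : v ≫ inj = inj' ≫ (bcFunctor E ℂ).map (C.cpt.X.map f)) (y' : AlgPoints Y' ℂ) (y : AlgPoints Y ℂ)
    (i : ℕ) :
    haveI := hY.geometricallyIrreducible
    haveI := hY'.geometricallyIrreducible
    BettiUniverse.pull (albOnPiece (C.alb K') inj' y') i ∘ₗ
        BettiUniverse.pull (AbelianVariety.Hom.baseChange ℂ (C.Atr f)).hom.hom.hom i =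
      BettiUniverse.pull v i ∘ₗ BettiUniverse.pull (albOnPiece (C.alb K) inj y) i :=
  pull_albOnPiece_comp_baseChange (C.alb K) inj (C.alb K') (C.cpt.X.map f) (C.nablaTr f) (C.Atr f) inj' v hY hY'
    (C.nablaTr_incl f) (C.α_Atr f) hv y' y i

/-- **LAW (iv), the HECKE square at Liu's §4.2 datum**: for Hecke translate data `T` on `{X_K}_K` (`AppendixC/HeckeTranslates`,
[Liu2021] §4.2 l. 2074 «the Hecke correspondences provide a homomorphism `𝔾(𝔸_F^∞) → Aut_E(A_∞)`», level by level `Alb(T_g) =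
T.albTr g K K' h : A_K → A_{K'}`) and pieces `Y ↪ X_K ⊗ ℂ`, `Y' ↪ X_{K'} ⊗ ℂ` with `w : Y ⟶ Y'` over `(T_g)_ℂ`:
`albPair (C.alb K) inj ≫ (Alb(T_g))_ℂ = (w × w) ≫ albPair (C.alb K') inj'`. [cite: Liu2021, §4.2 l. 2070–2074 and Def. 2.3 (l. 1206–1208)] -/
theorem albPair_comp_baseChange_albTr [GeometricallyIrreducible Y.hom] [GeometricallyIrreducible Y'.hom]
    (T : C.HeckeTranslates) (g : C.G) (h : C5.HeckeLE g K K') (w : Y ⟶ Y')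
    (hw : w ≫ inj' = inj ≫ (bcFunctor E ℂ).map (T.tr g K K' h)) :
    albPair (C.alb K) inj ≫ (AbelianVariety.Hom.baseChange ℂ (T.albTr g K K' h)).hom.hom.hom =
      (w ⊗ₘ w) ≫ albPair (C.alb K') inj' :=
  albPair_comp_baseChange_map (C.alb K') inj' (C.alb K) (T.tr g K K' h) inj w hw

/-- LAW (iv), pointed form: `(α_K)_{y}|_Y ≫ (Alb(T_g))_ℂ = w ≫ (α_{K'})_{w(y)}|_{Y'}`. [cite: Liu2021, §4.2 l. 2070–2074 and Def. 2.3 (l. 1206–1208)] -/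
theorem albOnPiece_comp_baseChange_albTr [GeometricallyIrreducible Y.hom] [GeometricallyIrreducible Y'.hom]
    (T : C.HeckeTranslates) (g : C.G) (h : C5.HeckeLE g K K') (w : Y ⟶ Y')
    (hw : w ≫ inj' = inj ≫ (bcFunctor E ℂ).map (T.tr g K K' h)) (y : AlgPoints Y ℂ) :
    albOnPiece (C.alb K) inj y ≫ (AbelianVariety.Hom.baseChange ℂ (T.albTr g K K' h)).hom.hom.hom =
      w ≫ albOnPiece (C.alb K') inj' (y ≫ w) :=
  albOnPiece_comp_baseChange_map (C.alb K') inj' (C.alb K) (T.tr g K K' h) inj w hw y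

/-- LAW (iv) on `Hⁱ`, any base points (the shape of the Δ2 bridge's Hecke law `hU` ∕ `hjH`). [cite: Liu2021, §4.2 l. 2070–2074 and proof of Lemma 2.4 (1) (l. 1226–1228)] -/
theorem pull_albOnPiece_comp_baseChange_albTr {n n' : ℕ} (hY : IsSmoothProjective n Y) (hY' : IsSmoothProjective n' Y')
    (T : C.HeckeTranslates) (g : C.G) (h : C5.HeckeLE g K K') (w : Y ⟶ Y')
    (hw : w ≫ inj' = inj ≫ (bcFunctor E ℂ).map (T.tr g K K' h)) (y : AlgPoints Y ℂ) (y' : AlgPoints Y' ℂ) (i : ℕ) :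
    haveI := hY.geometricallyIrreducible
    haveI := hY'.geometricallyIrreducible
    BettiUniverse.pull (albOnPiece (C.alb K) inj y) i ∘ₗ
        BettiUniverse.pull (AbelianVariety.Hom.baseChange ℂ (T.albTr g K K' h)).hom.hom.hom i =
      BettiUniverse.pull w i ∘ₗ BettiUniverse.pull (albOnPiece (C.alb K') inj' y') i :=
  pull_albOnPiece_comp_baseChange_map (C.alb K') inj' (C.alb K) (T.tr g K K' h) inj w hY' hY hw y y' i

end Sec42

end Summit.HodgeConjecture.CorCM.D2Bridge

end
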